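import Literature.NumberTheory.EllipticCurves.EisensteinNumbersArea
import Literature.NumberTheory.EllipticCurves.EisensteinKroneckerNumbers
import Literature.NumberTheory.ComplexMultiplication.EllipticUnits.DivisionPointsIndex
import Literature.NumberTheory.QuadraticFields.HeegnerCondition
import HarnessLib

/-!
# de Shalit's `A(L) = π⁻¹·Area(ℂ/L)` on CM lattices: `A(𝔞⁻¹Λ)⁻¹ = N𝔞·A(Λ)⁻¹`,
# `A(Ω𝒪_K)⁻¹ = 2π/(|Ω|²√|d_K|)`, and the lattices `Ω𝔪`, `𝔠⁻¹(Ω𝔪)` of II.3.5 (13)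

Topic `NumberTheory/EllipticCurves` (theorems only; no definition, no named fact, no `sorry`).
Sequel of `EisensteinNumbersArea.lean` (`PeriodPair.areaInv_eq_pi_div_abs_im`:
`A(L)⁻¹ = π/|Im(ω̄₁ω₂)|` for every period pair). Here the constant is evaluated on the lattices
that occur in de Shalit II.3.5 (13) — `E_{j,k}(Ω, 𝔠⁻¹𝔪Ω) = (k−1)!·A(L)^j·Σ…` (II.3.1 (6), the
tree's `PeriodPair.eisensteinKronecker` carries `areaInv ^ j`) — in the currency `ι : K →+* ℂ`,
`IsCMLattice`, `idealInvLattice` of the elliptic-units files (`ThetaSingularValues.lean`):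

* §2 `PeriodPair.areaInv_of_idealInvLattice` — **`A(𝔞⁻¹Λ)⁻¹ = N𝔞 · A(Λ)⁻¹`** for `K` imaginary
  quadratic, `Λ` with `𝒪_K`-multiplication, `𝔞 ≠ 0` (`Area(ℂ/𝔞⁻¹Λ) = Area(ℂ/Λ)/N𝔞`: the tree's
  `areaInv_eq_of_reps` with `#(𝔞⁻¹Λ/Λ) = N𝔞`, `IsLatticeReps.card_eq_absNorm`).
* §3 `PeriodPair.areaInv_of_lattice_eq_smul_ringOfIntegers` — **`A(Ω·𝒪_K)⁻¹ = 2π/(|Ω|²√|d_K|)`**,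
  i.e. `Area(ℂ/Ω𝒪_K) = |Ω|²·√|d_K|/2`, for any period pair with `z ∈ Λ ↔ ∃ a ∈ 𝒪_K, z = Ω·ι a`:
  from an integral basis `(1, ω)` (the tree's `Quadratic.exists_basis_zero_eq_one`,
  `discr_eq_sq_add_four_mul`: `ω² = m + tω`, `d_K = t² + 4m`) one has `(2ι(ω) − t)² = d_K < 0`, so
  `|Im ι(ω)| = √|d_K|/2`, and `(Ω·ι(ω), Ω)` is a basis of `Ω𝒪_K`
  (`exists_periodPair_smul_ringOfIntegers`).
* §4 `PeriodPair.areaInv_of_lattice_eq_smul_ideal`, `PeriodPair.areaInv_of_idealInvLattice_smul_ideal`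
  — **`A(Ω·𝔪)⁻¹ = 2π/(N𝔪·|Ω|²·√|d_K|)`** and **`A(𝔠⁻¹·Ω𝔪)⁻¹ = 2π·N𝔠/(N𝔪·|Ω|²·√|d_K|)`**
  (`𝔪⁻¹(Ω𝔪) = Ω𝒪_K`, `mem_idealInvLattice_smul_ideal_iff`: `y𝔪 ⊆ 𝔪 ⇒ y ∈ 𝒪_K`; then §2, §3).
  This is the factor `(√d_K/2π)^j` of de Shalit II.3.5 (13) / II Thm. 4.14 (36) at `j ≠ 0` (up to
  the unit `(√d_K/√|d_K|)^j` absorbed by the tree's `δ`, `δ² = ±d_K`, in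
  `DeShalit1987.interpolationValue`).

## References
* [deShalit1987] E. de Shalit, *Iwasawa theory of elliptic curves with complex multiplication*
  (1987), II.2.1 (4)–(6) (p. 41), II.2.3 (10) (p. 42), II.3.1 (6) (p. 50), II.3.5 (13) (p. 54).
* Tree: `EisensteinNumbersArea`, `EisensteinNumbers` (`areaInv_eq_of_reps`,
  `areaInv_eq_of_lattice_eq`), `DivisionPointsIndex` (`IsLatticeReps.card_eq_absNorm`),
  `ThetaSingularValues` (`IsCMLattice`, `idealInvLattice`, `IsLatticeReps.exists`),
  `QuadraticFields.HeegnerCondition` (`exists_basis_zero_eq_one`, `basis_one_mul_self_eq`,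
  `discr_eq_sq_add_four_mul`); Mathlib `isIntegral_of_smul_mem_submodule`.
-/

noncomputable section

open Complex
open scoped ComplexConjugate

namespace PeriodPair

/-! ### §2. Index scaling on CM lattices: `A(𝔞⁻¹Λ)⁻¹ = N𝔞 · A(Λ)⁻¹` -/

section CM

open NumberField
open Literature.NumberTheory.EllipticCurves (IsImaginaryQuadratic)
open Literature.NumberTheory.ComplexMultiplication.EllipticUnits

variable {K : Type} [Field K] [NumberField K]

/-- **`A(𝔞⁻¹Λ)⁻¹ = N𝔞 · A(Λ)⁻¹`** (`Area(ℂ/𝔞⁻¹Λ) = Area(ℂ/Λ)/N𝔞`): for `K` imaginary quadratic, a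
lattice `Λ` with `𝒪_K`-multiplication, `𝔞 ≠ 0` integral and `La` of lattice `𝔞⁻¹Λ` — the tree's
`areaInv_eq_of_reps` (`A(Λ')⁻¹ = #(Λ'/Λ)·A(Λ)⁻¹`) with `#(𝔞⁻¹Λ/Λ) = N𝔞`
(`IsLatticeReps.card_eq_absNorm`). [cite: deShalit1987, II.2.1 (4), II.3.1 (6)] -/
theorem areaInv_of_idealInvLattice (hK : IsImaginaryQuadratic K) (ι : K →+* ℂ)
    {L La : PeriodPair} {𝔞 : Ideal (𝓞 K)} (hL : IsCMLattice ι L.lattice) (h𝔞 : 𝔞 ≠ ⊥)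
    (hLa : La.lattice = idealInvLattice ι 𝔞 L.lattice) :
    La.areaInv = (Ideal.absNorm 𝔞 : ℂ) * L.areaInv := by
  obtain ⟨S, hS⟩ := PeriodPair.IsLatticeReps.exists (L := L) (L' := La)
    (hLa ▸ le_idealInvLattice hL 𝔞)
  rw [areaInv_eq_of_reps hS.mem_iff hS.zero_mem hS.distinct, hS.card_eq_absNorm hK ι hL h𝔞 hLa]

/-! ### §3. `A(Ω·𝒪_K)⁻¹ = 2π / (|Ω|²·√|d_K|)` -/

/-- The image of an integral-basis element `ω` (`(1, ω)` a `ℤ`-basis of `𝒪_K`, `ω² = m + tω`,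
`d_K = t² + 4m < 0`) under `ι : K → ℂ` has `Re ι(ω) = t/2` and `(Im ι(ω))² = |d_K|/4`:
`(2ι(ω) − t)² = d_K`. [folklore] -/
private theorem im_sq_of_basis (hK : IsImaginaryQuadratic K) (ι : K →+* ℂ)
    (b : Module.Basis (Fin 2) ℤ (𝓞 K)) (hb : b 0 = 1) :
    (2 * (ι ((b 1 : 𝓞 K) : K))).im ^ 2 = -(NumberField.discr K : ℝ) ∧
      (ι ((b 1 : 𝓞 K) : K)).im ≠ 0 := by
  set ω : 𝓞 K := b 1 with hω
  set m : ℤ := b.repr (ω * ω) 0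
  set t : ℤ := b.repr (ω * ω) 1
  have hωω : ω * ω = (m : 𝓞 K) + (t : 𝓞 K) * ω :=
    Literature.NumberTheory.QuadraticFields.Quadratic.basis_one_mul_self_eq b hb
  have hd : NumberField.discr K = t ^ 2 + 4 * m :=
    Literature.NumberTheory.QuadraticFields.Quadratic.discr_eq_sq_add_four_mul b hb
  set θ : ℂ := ι ((ω : 𝓞 K) : K) with hθ
  have hθθ : θ * θ = (m : ℂ) + (t : ℂ) * θ := by
    have h := congrArg (fun x : 𝓞 K ↦ ι (x : K)) hωω
    simpa only [map_mul, map_add, map_intCast] using h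
  -- `u = 2θ − t` has `u² = d_K`, a negative real number
  set u : ℂ := 2 * θ - t with hu
  have hu2 : u * u = (NumberField.discr K : ℂ) := by
    rw [hd]; push_cast; rw [hu]; linear_combination 4 * hθθ
  have hre : u.re * u.re - u.im * u.im = (NumberField.discr K : ℝ) := by
    have := congrArg Complex.re hu2
    simpa [Complex.mul_re] using this
  have him : u.re * u.im = 0 := by
    have := congrArg Complex.im hu2
    simp only [Complex.mul_im, Complex.intCast_im] at this
    linarith
  have hdneg : (NumberField.discr K : ℝ) < 0 := by exact_mod_cast hK.discr_neg
  have hure : u.re = 0 := by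
    rcases mul_eq_zero.mp him with h | h
    · exact h
    · exfalso
      rw [h, mul_zero, sub_zero] at hre
      nlinarith [mul_self_nonneg u.re]
  rw [hure, zero_mul, zero_sub] at hre
  have huim : u.im = (2 * θ).im := by
    rw [hu, Complex.sub_im, Complex.intCast_im, sub_zero]
  refine ⟨?_, fun h0 ↦ ?_⟩
  · rw [← huim]; nlinarith [hre]
  · have : u.im = 0 := by rw [huim, Complex.mul_im]; simp [h0]
    rw [this, mul_zero, neg_zero] at hre
    linarith

/-- `Ω ≠ 0` when `Λ_L = Ω·S` for a period lattice. [folklore] -/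
private theorem ne_zero_of_forall_mem_iff {L : PeriodPair} {Ω : ℂ} {P : ℂ → Prop}
    (hΛ : ∀ z, z ∈ L.lattice ↔ ∃ w : ℂ, P w ∧ z = Ω * w) : Ω ≠ 0 := by
  rintro rfl
  obtain ⟨w, -, hw⟩ := (hΛ L.ω₁).mp L.ω₁_mem_lattice
  exact (L.indep.ne_zero 0) (by simpa using hw)

/-- **A period pair for `Ω·ι(𝒪_K)`** with computed area: for `K` imaginary quadratic, `ι : K → ℂ`
and `Ω ≠ 0` there is a period pair `L₁` whose lattice is `Ω·ι(𝒪_K)` and with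
`A(L₁)⁻¹ = 2π/(|Ω|²√|d_K|)` (basis `(Ω·ι(ω), Ω)` for an integral basis `(1, ω)`,
`|Im ι(ω)| = √|d_K|/2`). [cite: deShalit1987, II.2.1 (4)] -/
theorem exists_periodPair_smul_ringOfIntegers (hK : IsImaginaryQuadratic K) (ι : K →+* ℂ)
    {Ω : ℂ} (hΩ : Ω ≠ 0) :
    ∃ L₁ : PeriodPair, (∀ z, z ∈ L₁.lattice ↔ ∃ a : 𝓞 K, z = Ω * ι (a : K)) ∧
      L₁.areaInv = (2 * Real.pi / (‖Ω‖ ^ 2 * Real.sqrt |(NumberField.discr K : ℝ)|) : ℝ) := by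
  obtain ⟨b, hb⟩ := Literature.NumberTheory.QuadraticFields.Quadratic.exists_basis_zero_eq_one hK.1
  obtain ⟨hsq, hne⟩ := im_sq_of_basis hK ι b hb
  obtain ⟨θ, hθ⟩ : ∃ θ : ℂ, θ = ι ((b 1 : 𝓞 K) : K) := ⟨_, rfl⟩
  rw [← hθ] at hsq hne
  -- the period pair `(Ωθ, Ω)`
  have hind : LinearIndependent ℝ ![Ω * θ, Ω] := by
    refine LinearIndependent.pair_iff.mpr fun s r h ↦ ?_
    rw [Complex.real_smul, Complex.real_smul] at h
    have h' : Ω * ((s : ℂ) * θ + r) = 0 := by linear_combination h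
    have h'' : (s : ℂ) * θ + r = 0 := (mul_eq_zero.mp h').resolve_left hΩ
    have hs : s = 0 := by
      have := congrArg Complex.im h''
      simp only [Complex.add_im, Complex.mul_im, Complex.ofReal_re, Complex.ofReal_im, zero_mul,
        add_zero, Complex.zero_im] at this
      exact (mul_eq_zero.mp this).resolve_right hne
    refine ⟨hs, ?_⟩
    rw [hs] at h''
    simpa using h''
  let L₁ : PeriodPair := ⟨Ω * θ, Ω, hind⟩
  refine ⟨L₁, fun z ↦ ?_, ?_⟩
  · rw [PeriodPair.mem_lattice]
    constructor
    · rintro ⟨p, q, rfl⟩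
      refine ⟨(q : 𝓞 K) + (p : 𝓞 K) * b 1, ?_⟩
      simp only [map_add, map_mul, map_intCast]
      rw [← hθ]
      change (p : ℂ) * (Ω * θ) + q * Ω = Ω * (q + p * θ)
      ring
    · rintro ⟨a, rfl⟩
      refine ⟨b.repr a 1, b.repr a 0, ?_⟩
      have ha : a = (b.repr a 0 : 𝓞 K) + (b.repr a 1 : 𝓞 K) * b 1 := by
        conv_lhs => rw [← b.sum_repr a]
        rw [Fin.sum_univ_two, hb, zsmul_eq_mul, mul_one, zsmul_eq_mul]
      have hιa : ι ((a : 𝓞 K) : K) = (b.repr a 0 : ℂ) + (b.repr a 1 : ℂ) * θ := by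
        conv_lhs => rw [ha]
        simp only [map_add, map_mul, map_intCast]
        rw [← hθ]
      rw [hιa]
      change ((b.repr a 1 : ℤ) : ℂ) * (Ω * θ) + (b.repr a 0 : ℤ) * Ω =
        Ω * ((b.repr a 0 : ℤ) + (b.repr a 1 : ℤ) * θ)
      ring
  · rw [areaInv_eq_pi_div_abs_im]
    change (Real.pi : ℂ) / (|(conj (Ω * θ) * Ω).im| : ℝ) = _
    have him : (conj (Ω * θ) * Ω).im = -(‖Ω‖ ^ 2 * θ.im) := by
      rw [map_mul, mul_comm, ← mul_assoc, Complex.mul_conj, Complex.normSq_eq_norm_sq,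
        Complex.im_ofReal_mul, Complex.conj_im]
      ring
    have hθim : |θ.im| = Real.sqrt |(NumberField.discr K : ℝ)| / 2 := by
      have hdneg : (NumberField.discr K : ℝ) < 0 := by exact_mod_cast hK.discr_neg
      rw [abs_of_neg hdneg, ← hsq, Complex.mul_im]
      simp only [Complex.re_ofNat, Complex.im_ofNat, zero_mul, add_zero]
      rw [show ((2 : ℝ) * θ.im) ^ 2 = (2 * |θ.im|) ^ 2 by rw [mul_pow, mul_pow, sq_abs],
        Real.sqrt_sq (by positivity)]
      ring
    rw [him, abs_neg, abs_mul, abs_of_nonneg (by positivity), hθim]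
    push_cast
    ring

/-- **`A(Ω·𝒪_K)⁻¹ = 2π/(|Ω|²·√|d_K|)`** (`Area(ℂ/Ω𝒪_K) = |Ω|²·√|d_K|/2`): for `K` imaginary
quadratic, `ι : K → ℂ` and ANY period pair `L` whose lattice is `Ω·ι(𝒪_K)` (the currency
`z ∈ Λ ↔ ∃ a ∈ 𝒪_K, z = Ω·ι a` of the elliptic-units files). [cite: deShalit1987, II.2.1 (4)] -/
theorem areaInv_of_lattice_eq_smul_ringOfIntegers (hK : IsImaginaryQuadratic K) (ι : K →+* ℂ)
    {L : PeriodPair} {Ω : ℂ} (hΛ : ∀ z, z ∈ L.lattice ↔ ∃ a : 𝓞 K, z = Ω * ι (a : K)) :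
    L.areaInv = (2 * Real.pi / (‖Ω‖ ^ 2 * Real.sqrt |(NumberField.discr K : ℝ)|) : ℝ) := by
  have hΩ : Ω ≠ 0 := ne_zero_of_forall_mem_iff (P := fun w ↦ ∃ a : 𝓞 K, w = ι (a : K))
    (fun z ↦ (hΛ z).trans ⟨fun ⟨a, ha⟩ ↦ ⟨_, ⟨a, rfl⟩, ha⟩, fun ⟨_, ⟨a, rfl⟩, h⟩ ↦ ⟨a, h⟩⟩)
  obtain ⟨L₁, hL₁, hA⟩ := exists_periodPair_smul_ringOfIntegers hK ι hΩ
  have hlat : L.lattice = L₁.lattice := by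
    ext z; rw [hΛ z, hL₁ z]
  rw [areaInv_eq_of_lattice_eq hlat, hA]

/-! ### §4. de Shalit's lattices `Ω·𝔪` and `𝔠⁻¹(Ω·𝔪)` of II.3.5 (13) -/

/-- An element `y ∈ K` with `y·𝔪 ⊆ 𝔪` for a non-zero ideal `𝔪 ⊆ 𝒪_K` is an algebraic integer
(`𝔪` is a faithful finitely generated `ℤ[y]`-module). [folklore] -/
private theorem exists_coe_eq_of_mul_mem {𝔪 : Ideal (𝓞 K)} (h𝔪 : 𝔪 ≠ ⊥) {y : K}
    (hy : ∀ a ∈ 𝔪, ∃ m ∈ 𝔪, (a : K) * y = (m : K)) : ∃ x : 𝓞 K, (x : K) = y := by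
  -- `N = 𝔪 ⊂ K` as a `ℤ`-submodule
  let f : 𝓞 K →ₗ[ℤ] K := (Algebra.linearMap (𝓞 K) K).restrictScalars ℤ
  let N : Submodule ℤ K := (𝔪.restrictScalars ℤ).map f
  have hNfg : N.FG := (IsNoetherian.noetherian (𝔪.restrictScalars ℤ)).map f
  obtain ⟨a₀, ha₀, ha₀0⟩ := Submodule.exists_mem_ne_zero_of_ne_bot h𝔪
  have hNbot : N ≠ ⊥ := by
    rw [Submodule.ne_bot_iff]
    refine ⟨(a₀ : K), Submodule.mem_map.mpr ⟨a₀, ha₀, rfl⟩, ?_⟩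
    exact_mod_cast ha₀0
  have hint : IsIntegral ℤ y := by
    refine isIntegral_of_smul_mem_submodule N hNbot hNfg y fun n hn ↦ ?_
    obtain ⟨a, ha, rfl⟩ := Submodule.mem_map.mp hn
    obtain ⟨m, hm, ham⟩ := hy a ha
    refine Submodule.mem_map.mpr ⟨m, hm, ?_⟩
    change (m : K) = y • (a : K)
    rw [smul_eq_mul, mul_comm, ham]
  exact ⟨⟨y, hint⟩, rfl⟩

omit [NumberField K] in
/-- `Ω·ι(𝔪)` has `𝒪_K`-multiplication. [cite: deShalit1987, II.2.3] -/
theorem isCMLattice_of_lattice_eq_smul_ideal (ι : K →+* ℂ) {L₀ : PeriodPair} {Ω : ℂ}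
    {𝔪 : Ideal (𝓞 K)} (hΛ₀ : ∀ z, z ∈ L₀.lattice ↔ ∃ a ∈ 𝔪, z = Ω * ι (a : K)) :
    IsCMLattice ι L₀.lattice := by
  intro a z hz
  obtain ⟨m, hm, rfl⟩ := (hΛ₀ z).mp hz
  refine (hΛ₀ _).mpr ⟨a * m, Ideal.mul_mem_left 𝔪 a hm, ?_⟩
  simp only [map_mul]
  ring

/-- **`𝔪⁻¹(Ω·𝔪) = Ω·𝒪_K`**: for `𝔪 ≠ 0`, the colon lattice `idealInvLattice ι 𝔪 (Ω·ι𝔪)` is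
`Ω·ι(𝒪_K)` (`⊇`: `𝒪_K·𝔪 ⊆ 𝔪`; `⊆`: `y𝔪 ⊆ 𝔪 ⇒ y ∈ 𝒪_K`). [cite: deShalit1987, II.2.3 (10)] -/
theorem mem_idealInvLattice_smul_ideal_iff (ι : K →+* ℂ) {L₀ : PeriodPair} {Ω : ℂ}
    {𝔪 : Ideal (𝓞 K)} (h𝔪 : 𝔪 ≠ ⊥) (hΛ₀ : ∀ z, z ∈ L₀.lattice ↔ ∃ a ∈ 𝔪, z = Ω * ι (a : K))
    (z : ℂ) : z ∈ idealInvLattice ι 𝔪 L₀.lattice ↔ ∃ x : 𝓞 K, z = Ω * ι (x : K) := by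
  have hΩ : Ω ≠ 0 := ne_zero_of_forall_mem_iff (P := fun w ↦ ∃ a ∈ 𝔪, w = ι (a : K))
    (fun z ↦ (hΛ₀ z).trans ⟨fun ⟨a, ha, h⟩ ↦ ⟨_, ⟨a, ha, rfl⟩, h⟩, fun ⟨_, ⟨a, ha, rfl⟩, h⟩ ↦ ⟨a, ha, h⟩⟩)
  rw [mem_idealInvLattice_iff]
  constructor
  · intro h
    obtain ⟨a₀, ha₀, ha₀0⟩ := Submodule.exists_mem_ne_zero_of_ne_bot h𝔪
    obtain ⟨m₀, hm₀, h₀⟩ := (hΛ₀ _).mp (h a₀ ha₀)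
    have ha₀K : ((a₀ : 𝓞 K) : K) ≠ 0 := by exact_mod_cast ha₀0
    -- `z = Ω·ι(y)`, `y = m₀/a₀ ∈ K`
    set y : K := (m₀ : K) / (a₀ : K) with hy
    have hz : z = Ω * ι y := by
      have h1 : ι ((a₀ : 𝓞 K) : K) ≠ 0 := (map_ne_zero ι).mpr ha₀K
      rw [hy, map_div₀]
      field_simp
      linear_combination h₀
    -- `y·𝔪 ⊆ 𝔪`
    have hyint : ∀ a ∈ 𝔪, ∃ m ∈ 𝔪, (a : K) * y = (m : K) := by
      intro a ha
      obtain ⟨m, hm, ham⟩ := (hΛ₀ _).mp (h a ha)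
      refine ⟨m, hm, ι.injective ?_⟩
      rw [hz] at ham
      have : Ω * (ι ((a : 𝓞 K) : K) * ι y) = Ω * ι ((m : 𝓞 K) : K) := by
        linear_combination ham
      simpa only [map_mul] using mul_left_cancel₀ hΩ this
    obtain ⟨x, hx⟩ := exists_coe_eq_of_mul_mem h𝔪 hyint
    exact ⟨x, by rw [hx, hz]⟩
  · rintro ⟨x, rfl⟩ a ha
    refine (hΛ₀ _).mpr ⟨a * x, Ideal.mul_mem_right x 𝔪 ha, ?_⟩
    simp only [map_mul]
    ring

/-- **`A(Ω·𝔪)⁻¹ = 2π/(N𝔪·|Ω|²·√|d_K|)`** (`Area(ℂ/Ω𝔪) = N𝔪·|Ω|²·√|d_K|/2`): for `K` imaginary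
quadratic, `ι : K → ℂ`, `𝔪 ≠ 0` integral and a period pair `L₀` of lattice `Ω·ι(𝔪)` — from
`𝔪⁻¹(Ω𝔪) = Ω𝒪_K` (`A(Ω𝒪_K)⁻¹ = N𝔪·A(Ω𝔪)⁻¹`, §2) and §3. [cite: deShalit1987, II.2.1 (4), II.3.5 (13)] -/
theorem areaInv_of_lattice_eq_smul_ideal (hK : IsImaginaryQuadratic K) (ι : K →+* ℂ)
    {L₀ : PeriodPair} {Ω : ℂ} {𝔪 : Ideal (𝓞 K)} (h𝔪 : 𝔪 ≠ ⊥)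
    (hΛ₀ : ∀ z, z ∈ L₀.lattice ↔ ∃ a ∈ 𝔪, z = Ω * ι (a : K)) :
    L₀.areaInv = (2 * Real.pi /
      (Ideal.absNorm 𝔪 * ‖Ω‖ ^ 2 * Real.sqrt |(NumberField.discr K : ℝ)|) : ℝ) := by
  have hΩ : Ω ≠ 0 := ne_zero_of_forall_mem_iff (P := fun w ↦ ∃ a ∈ 𝔪, w = ι (a : K))
    (fun z ↦ (hΛ₀ z).trans ⟨fun ⟨a, ha, h⟩ ↦ ⟨_, ⟨a, ha, rfl⟩, h⟩, fun ⟨_, ⟨a, ha, rfl⟩, h⟩ ↦ ⟨a, ha, h⟩⟩)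
  obtain ⟨L₁, hL₁, hA₁⟩ := exists_periodPair_smul_ringOfIntegers hK ι hΩ
  have hlat : L₁.lattice = idealInvLattice ι 𝔪 L₀.lattice := by
    ext z; rw [hL₁ z, mem_idealInvLattice_smul_ideal_iff ι h𝔪 hΛ₀ z]
  have hidx := areaInv_of_idealInvLattice hK ι (isCMLattice_of_lattice_eq_smul_ideal ι hΛ₀) h𝔪 hlat
  have hN : (Ideal.absNorm 𝔪 : ℂ) ≠ 0 := by
    exact_mod_cast (Ideal.absNorm_eq_zero_iff.not.mpr h𝔪)
  rw [hA₁] at hidx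
  have : L₀.areaInv = (2 * Real.pi / (‖Ω‖ ^ 2 * Real.sqrt |(NumberField.discr K : ℝ)|) : ℝ) /
      (Ideal.absNorm 𝔪 : ℂ) := by
    rw [eq_div_iff hN, mul_comm, ← hidx]
  rw [this]
  push_cast
  rw [div_div]
  ring_nf

/-- **`A(𝔠⁻¹·Ω𝔪)⁻¹ = 2π·N𝔠/(N𝔪·|Ω|²·√|d_K|)`** — the constant `A(L)` of de Shalit's lattice
`L = 𝔠⁻¹𝔪Ω` in II.3.5 (13) (`E_{j,k}(Ω, 𝔠⁻¹𝔪Ω) = (k−1)!·A(L)^j·Σ…`), hence the factor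
`(√|d_K|/2π)^j` there: for `K` imaginary quadratic, `ι`, `𝔪, 𝔠 ≠ 0` integral, `L₀` of lattice
`Ω·ι(𝔪)` and `L'` of lattice `idealInvLattice ι 𝔠 Λ_{L₀}`. [cite: deShalit1987, II.2.1 (4), II.3.5 (13)] -/
theorem areaInv_of_idealInvLattice_smul_ideal (hK : IsImaginaryQuadratic K) (ι : K →+* ℂ)
    {L₀ L' : PeriodPair} {Ω : ℂ} {𝔪 𝔠 : Ideal (𝓞 K)} (h𝔪 : 𝔪 ≠ ⊥) (h𝔠 : 𝔠 ≠ ⊥)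
    (hΛ₀ : ∀ z, z ∈ L₀.lattice ↔ ∃ a ∈ 𝔪, z = Ω * ι (a : K))
    (hL' : L'.lattice = idealInvLattice ι 𝔠 L₀.lattice) :
    L'.areaInv = (2 * Real.pi * Ideal.absNorm 𝔠 /
      (Ideal.absNorm 𝔪 * ‖Ω‖ ^ 2 * Real.sqrt |(NumberField.discr K : ℝ)|) : ℝ) := by
  rw [areaInv_of_idealInvLattice hK ι (isCMLattice_of_lattice_eq_smul_ideal ι hΛ₀) h𝔠 hL',
    areaInv_of_lattice_eq_smul_ideal hK ι h𝔪 hΛ₀]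
  push_cast
  ring

/-- **de Shalit II.3.5 (13), the transcendental factor made explicit**: for `L' = 𝔠⁻¹𝔪Ω` as
above and the tree's `E_{−j,k}` in the absolutely convergent range (`PeriodPair.eisensteinKronecker`,
II.3.1 (6)), `E_{−j,k}(z, L') = (k−1)!·(2π·N𝔠/(N𝔪·|Ω|²·√|d_K|))^j·Σ_{ω ∈ L'} (z̄ + ω̄)^j (z + ω)^{−k}`
— the `A(L)^j = (2π/√|d_K|)^j·(…)` of (13); the remaining ideal-theoretic sum is II.3.5's
"straightforward computation". [cite: deShalit1987, II.3.1 (6), II.3.5 (13)] -/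
theorem eisensteinKronecker_of_idealInvLattice_smul_ideal (hK : IsImaginaryQuadratic K)
    (ι : K →+* ℂ) {L₀ L' : PeriodPair} {Ω : ℂ} {𝔪 𝔠 : Ideal (𝓞 K)} (h𝔪 : 𝔪 ≠ ⊥) (h𝔠 : 𝔠 ≠ ⊥)
    (hΛ₀ : ∀ z, z ∈ L₀.lattice ↔ ∃ a ∈ 𝔪, z = Ω * ι (a : K))
    (hL' : L'.lattice = idealInvLattice ι 𝔠 L₀.lattice) (j k : ℕ) (z : ℂ) :
    L'.eisensteinKronecker j k z = ((k - 1).factorial : ℂ) *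
      ((2 * Real.pi * Ideal.absNorm 𝔠 /
        (Ideal.absNorm 𝔪 * ‖Ω‖ ^ 2 * Real.sqrt |(NumberField.discr K : ℝ)|) : ℝ) : ℂ) ^ j *
      ∑' ω : L'.lattice, conj (z + ω) ^ j * ((z + ω) ^ k)⁻¹ := by
  rw [eisensteinKronecker_def, areaInv_of_idealInvLattice_smul_ideal hK ι h𝔪 h𝔠 hΛ₀ hL']

end CM

end PeriodPair

end
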